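import Summits.AnomalousDissipation.AnomalousDissipation.Theorems.SawtoothPulseCascadeK1LocalisedCascadeKHStableDetuning
import Mathlib.Analysis.Real.Pi.Bounds

/-!
# K2 lane (route-2 `SawtoothPulseCascade`, crux dir `K1LocalisedCascade`): the stable kink-sheet block ROTATES — `ω(k,β) ≥ 0.55·k` for `k ≥ 1`

Sequel of `…KHStableDetuning` (ACL item stmt-AnomalousDissipation-19491; S2-cert forced part / P1″). The single-mode forcing of the sheet block has, besides the
kink phases `e^{∓iπks/2}`, a FREQUENCY-ZERO component (the trough/crest end points, `…KHForcingClosedForm`); its Duhamel integral against the block's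
`e^{±iωt}` is detuned by `ω` itself, so a LOWER bound on the rotation rate is needed:
* `normSq_sawS_le`: `|S_β(k)|² ≤ q/(k²(1−q)²)` (`q = e^{−2πk}`; denominator `1 − 2q cos + q² ≥ (1−q)²`, `2 + 2cos ≤ 4`);
* `kh_p_ge`: `π/2 + 2Σ₀(k,β) ≥ 0.5657` for `k ≥ 1`; `sawC2_ge`: `c²(k,β) ≥ 0.3025` for `k ≥ 1`;
* **`omega_ge`**: `0.55·k ≤ k·√(max 0 c²(k,β))` for `k ≥ 1` — with `omega_le` the stable block's rate is pinned in `[0.55k, πk/2 − 399/401]`.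
No definitions; no statement about the crux. [cite: Drazin2002, §8.3 (8.36)–(8.38)] [problem: turb]
-/

-- `Summit.<Summit>.<Problem>`: single-conjunct summit, the duplicate namespace segment is deliberate.
set_option linter.dupNamespace false

noncomputable section

namespace Summit.AnomalousDissipation.AnomalousDissipation.Theorems.SawtoothPulseCascade.K2PhaseBudget

open Set Literature.Analysis.FluidPDE.SawtoothCascade

/-- `|S_β(k)|² ≤ q/(k²(1−q)²)` for `k > 0`, `q = sawQ k`. [cite: Drazin2002, §8.3 (8.36)–(8.38)] -/
theorem normSq_sawS_le {k : ℝ} (hk : 0 < k) (β : ℝ) :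
    Complex.normSq (sawS k β) ≤ sawQ k / (k ^ 2 * (1 - sawQ k) ^ 2) := by
  rw [normSq_sawS hk.ne' β]
  have hq0 : 0 < sawQ k := sawQ_pos k
  have hq1 : sawQ k < 1 := sawQ_lt_one hk
  set q := sawQ k with hq
  have hc := Real.cos_le_one (2 * Real.pi * β)
  have hc' := Real.neg_one_le_cos (2 * Real.pi * β)
  have h1q : 0 < 1 - q := by linarith
  have hD : (1 - q) ^ 2 ≤ 1 - 2 * q * Real.cos (2 * Real.pi * β) + q ^ 2 := by nlinarith
  have hD0 : 0 < 1 - 2 * q * Real.cos (2 * Real.pi * β) + q ^ 2 := lt_of_lt_of_le (by positivity) hD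
  have hE : Real.exp (-(k * Real.pi)) ^ 2 = q := by
    rw [hq]; unfold sawQ; rw [← Real.exp_nat_mul]; congr 1; push_cast; ring
  -- `(e^{−kπ}/(2k))² (1−q)² (2+2cos) / D² ≤ (q/(4k²)) (1−q)² · 4 / (1−q)⁴`
  have hnum : (Real.exp (-(k * Real.pi)) / (2 * k)) ^ 2 * ((1 - q) ^ 2 * (2 + 2 * Real.cos (2 * Real.pi * β))) ≤
      q / (4 * k ^ 2) * ((1 - q) ^ 2 * 4) := by
    rw [div_pow, hE, show (2 * k) ^ 2 = 4 * k ^ 2 by ring]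
    apply mul_le_mul_of_nonneg_left _ (by positivity)
    nlinarith
  have hden : (1 - q) ^ 2 * (1 - q) ^ 2 ≤ (1 - 2 * q * Real.cos (2 * Real.pi * β) + q ^ 2) ^ 2 := by
    rw [← mul_pow]; rw [show ((1 - q) * (1 - q)) = (1 - q) ^ 2 by ring]
    exact pow_le_pow_left₀ (by positivity) hD 2
  calc (Real.exp (-(k * Real.pi)) / (2 * k)) ^ 2 * ((1 - q) ^ 2 * (2 + 2 * Real.cos (2 * Real.pi * β))) /
        (1 - 2 * q * Real.cos (2 * Real.pi * β) + q ^ 2) ^ 2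
      ≤ q / (4 * k ^ 2) * ((1 - q) ^ 2 * 4) / ((1 - q) ^ 2 * (1 - q) ^ 2) := by
        apply div_le_div₀ (by positivity) hnum (by positivity) hden
    _ = q / (k ^ 2 * (1 - q) ^ 2) := by field_simp

/-- `π/2 + 2Σ₀(k,β) ≥ 0.5657` for `k ≥ 1` (`2Σ₀ ≥ −(1+q)/(k(1−q)) ≥ −401/399`, `π > 3.1415`). [cite: Drazin2002, §8.3 (8.36)–(8.38)] -/
theorem kh_p_ge {k : ℝ} (hk : 1 ≤ k) (β : ℝ) : 0.5657 ≤ Real.pi / 2 + 2 * sawSigma0 k β := by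
  have hk0 : 0 < k := by linarith
  have h := le_sawSigma0_of_pos hk0 β
  have hq0 : 0 < sawQ k := sawQ_pos k
  have hq := sawQ_le_of_one_le hk
  have hπ : (3.1415 : ℝ) < Real.pi := Real.pi_gt_d4
  set q := sawQ k
  have h1q : 0 < 1 - q := by linarith
  have hb : (1 + q) / (2 * k * (1 - q)) ≤ 401 / 798 := by
    rw [div_le_div_iff₀ (by positivity) (by norm_num)]
    nlinarith
  have : -(1 + q) / (2 * k * (1 - q)) = -((1 + q) / (2 * k * (1 - q))) := by rw [neg_div]
  rw [this] at h
  linarith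

/-- `c²(k,β) ≥ 0.3025` for `k ≥ 1` (`c² = p² − 4|S|²`, `p ≥ 0.5657`, `4|S|² ≤ 4q/(k²(1−q)²) ≤ 0.0101`). [cite: Drazin2002, §8.3 (8.36)–(8.38)] -/
theorem sawC2_ge {k : ℝ} (hk : 1 ≤ k) (β : ℝ) : 0.3025 ≤ sawC2 k β := by
  have hk0 : 0 < k := by linarith
  unfold sawC2
  have hp := kh_p_ge hk β
  have hS := normSq_sawS_le hk0 β
  have hq0 : 0 < sawQ k := sawQ_pos k
  have hq := sawQ_le_of_one_le hk
  set q := sawQ k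
  have h1q : 0 < 1 - q := by linarith
  have hS' : sawQ k / (k ^ 2 * (1 - sawQ k) ^ 2) ≤ 1 / 396 := by
    rw [div_le_div_iff₀ (by positivity) (by norm_num)]
    have hk2 : 1 ≤ k ^ 2 := by nlinarith
    nlinarith [mul_le_mul hk2 (show (399/400 : ℝ) ^ 2 ≤ (1 - q) ^ 2 by nlinarith) (by positivity) (by positivity)]
  have hp2 : (0.5657 : ℝ) ^ 2 ≤ (Real.pi / 2 + 2 * sawSigma0 k β) ^ 2 := pow_le_pow_left₀ (by norm_num) hp 2
  nlinarith

/-- **The stable block rotates: `0.55·k ≤ ω(k,β) = k·√(max 0 c²(k,β))`** for `k ≥ 1`. [cite: Drazin2002, §8.3 (8.36)–(8.38)] -/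
theorem omega_ge {k : ℝ} (hk : 1 ≤ k) (β : ℝ) : 0.55 * k ≤ k * Real.sqrt (max 0 (sawC2 k β)) := by
  have hk0 : 0 < k := by linarith
  have hc := sawC2_ge hk β
  have h1 : (0.55 : ℝ) ≤ Real.sqrt (max 0 (sawC2 k β)) := by
    rw [show (0.55 : ℝ) = Real.sqrt (0.55 ^ 2) by rw [Real.sqrt_sq (by norm_num)]]
    exact Real.sqrt_le_sqrt (le_max_of_le_right (by nlinarith))
  nlinarith

end Summit.AnomalousDissipation.AnomalousDissipation.Theorems.SawtoothPulseCascade.K2PhaseBudget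

end
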